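import Summits.BirchSwinnertonDyer.Rank1Residual.O5.HeegnerLogTransportThreeTwoSidedRow240930b1
import Summits.BirchSwinnertonDyer.Rank1Residual.O5.HeegnerLogTransportThreeHeegnerIndexEnd
import Summits.BirchSwinnertonDyer.Rank1Residual.AdditivePotMult.RankOneIndexCertificateOdd
import Literature.NumberTheory.EllipticCurves.HeegnerPointFiniteIndex
import HarnessLib
import HarnessLib.Audit.Tags

/-!
# Heegner-log transport at `p = 3` (KL3), part 32: the transport END in the cell's CLOSING CURRENCY —
# `BSD(W, 3)` for the (t′) curve from the companion's data, and the ROW OF RECORD `240930b1 ~ 26770a1`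
# (`K = ℚ(√−551)`): `BSDp 240930b1 3` (o5-r2 GEN 32)

HONEST FRAMING (cell `b2b-bsdres`, run/shared/lean/b2b/bsd-rank1-residual/, verbatim in every file): the
goal of the cell is to DELETE the COMBINATION-SHAPED residual classes of the Birch–Swinnerton-Dyer
formula for ALL analytic-rank `≤ 1` elliptic curves over `ℚ` — "full BSD formula for every rank `≤ 1`
curve in class `C`" assembled STRICTLY from published theorems — so that the rank-`≤ 1` remainder
becomes exactly the CONSTRUCTION-SHAPED classes, which are TYPED (missing-input `Prop`s), NOT
attempted. This is not "finishing BSD". Team O5/O6, seat o5-r2 (planner 2, non-Iwasawa side) works a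
RESEARCH ROUTE on the census cell O5 = (t′) (`p = 3`, `f₃ = 2`: additive, tame, potentially
supersingular); **O5 stays OPEN**; no claim beyond the stated rows; every theorem below is CONDITIONAL on
its displayed binders; census / instrument statements are EVIDENCE or displayed binders, never a
Literature fact; NOTHING is booked by this file and no mark / label / count / tier of `RESIDUAL-MAP.md`
moves (a per-pair closure is the referee's ruling).

THEOREMS + two curve-literal `def`s (a twist model and a change of variables); no named fact, no
`@[conjecture]`, no `sorry`; published inputs stay displayed hypotheses BY NAME, nothing re-proved.

## What this part does

Parts 15–31 of the KL3 line end in the HEEGNER-INDEX currency: `ord₃ [W(K) : ℤP_K] = 0` for the (t′)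
curve `W`, transported from a mod-`3` congruent companion `G` with good reduction at `3` through
Kriz–Li's congruence of `3`-adic logarithms of Heegner points (Thm. 1.16 BY NAME). The cell's closing
law for a rank-one pair at ANY odd bad prime — additive-p1's
`AdditivePotMult.bsdp_of_rankOne_of_indexCertificate` (gen 5; `…_of_dvd`, gen 10: Kolyvagin's bound via
McCallum 1991 §1 — no hypothesis at `p` —, Gross–Zagier, Gross–Zagier–Kolyvagin over `ℚ`, modularity,
all BY NAME) — consumes exactly such an index statement, as the certificate binder
`hI : ¬ p ∣ [E(K) : ℤP]`. This file composes the two: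

* §1 `bsdp_of_rankOne_of_indexUnit` — the closing law with `hI` REPLACED by a transported conclusion
  `hv : (P non-torsion) → ord_p [E(K) : ℤP] = 0`. The two side facts the replacement needs are derived,
  not assumed: the Heegner point is non-torsion (from `r_an(E) = 1`, `L(E^{d_K}, 1) ≠ 0` — read off the
  twist-value datum `q_d ≠ 0` — and Gross–Zagier BY NAME, exactly as in the closing law's own §2), and the
  index is FINITE (Kolyvagin BY NAME: `Literature…index_zmultiples_ne_zero_of_isHeegnerPoint`, asked as
  D-O5-G17-2), so that `ord_p = 0` means `p ∤ index` and not the junk value at `index = 0`.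
* §2 `o5_bsdp_of_good_companion_heegnerIndex` — the Heegner-index END of part 27b
  (`o5_index_unit_of_good_companion_heegnerIndex`: Kriz–Li Thm. 1.16 + modularity BY NAME, companion
  ordinary OR supersingular) in closing currency: `BSDp W 3`, the binder `hPinf` of the END DROPPED
  (derived), the closing law's binders added (`hGZ`, `hKo`, `hB` for `W/K`; `hGZK`, `hmodE`; `r_an(W) = 1`;
  `3 ∤ c(D)`; the twist model and its value datum `q_d`).
* §3 THE ROW OF RECORD `240930b1 ~ 26770a1`, `d_K = −551` (part 25c `o5_index_unit_row240930b1`, in the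
  tree): `o5_bsdp_row240930b1 : … → BSDp W240930b1 3`, with the twist's globally minimal model
  `Wd240930b1_551 = (1, 0, ½, 0) • 240930b1^{(−551)} = ⟨1, 413, 0, −1790254339134, −923018597583800140⟩`
  (`|Δ| = 2³⁴·3⁹·5²·19⁶·29⁶·2677`, `c₄` odd: Kraus-minimal, decided in the kernel; conductor
  `240930·551² = 73146588930`, beyond every table) and `u = 1`.

## Reconciliation with the DIRECT certificate (EVIDENCE, not used in any proof)

The same seven pairs `(W, K)` on which the KL3 line has row ENDs are KERNEL record rows of this seat's
gen-3 tables `O5/HeegnerIndexRecordsThreeRankOneT1/T2/T4.lean` (two independent engines, exact Heegner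
index `m₁ = m₂`, `ord₃ m = 0`): `m = 16` (`240930b1`, `−551`), `8` (`149895d1`, `−356`), `8` (`430425o1`,
`−344`), `28` (`23184z1`, `−551`), `8` (`162288ei1`, `−551`), `4` (`439569bw1`, `−263`), `8` (`439569e1`,
`−263`). The transport END's conclusion therefore holds AS DATA on every row of record, and §3 below and
the record-row reading of p238704 reach the SAME statement `BSDp 240930b1 3` by two different evidence
ledgers: the direct row displays the numerical Heegner index of `W` over `K` (height pairing on a curve of
conductor `240930`); the transport row displays instead Kriz–Li Thm. 1.16, the companion's `3`-Selmer
certificates and the two Heegner-point identifications. For the twist the record row gives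
`#F(ℚ)_tors = 2`, `∏ c_ℓ(F) = 64`, `#Ш_an(F) = 4`, so `ord₃ q_d = 0` (binder `hvd`).

References: [KrizLi2019] Thm. 1.16, Rem. 1.17; [McCallumLMS1991] §1; [GrossLMS1991] Thm. 1.3, Prop. 2.1;
[Kolyvagin1990] Thm. A; [GrossZagier1986] Thm. I.6.3, V.§2; [CaiShuTian2014] Thm. 1.1;
[JetchevSkinnerWan2017] §7.4.1; [Miller2011LMS] Def. 1.1; [YanZhu2026] Thm. 4.15; [Kraus1989] Prop. 1–2;
[SilvermanAEC2009] III.1, VII.1, X.5.4; [CremonaAlgorithms1997] §3.2 and Table 1; memo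
`HOME/b2b-bsdres-o5-r2/gen32/O5-GEN32.md`.

### cc-typer-5 GEN 20 (O5 §3.5 / O6 §3.4 typer of record) — by-name ask A-O5-G32-1 of o5-r2 GEN 32 (HOME/INBOX.md l.15720; re-stated GEN 33–38, l.16133 'STILL ASKED, PLACEABLE';
by sha, VERBATIM + ¶; memo gen32/O5-GEN32.md): part 32 606534105cbe88d5 → O5/HeegnerLogTransportThreeBSDp.lean. Source:
`HOME/b2b-bsdres-o5-r2/gen32/lean/HeegnerLogTransportThreeBSDp.lean` sha16 `606534105cbe88d5` (321 l.; `gen32/SHA16.txt`; o5-r2's farm checks rc 0 / 0 warnings / 0 sorries,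
axioms standard, dedup clean as stated in their line), re-hashed by the typer right before writing; THIS file = the source VERBATIM + this paragraph (imports, module text, every
declaration block byte-identical; script `class-closure/typer-5/gen20/gplace.py`, docstring anchor asserted); imports `O5.HeegnerLogTransportThreeTwoSidedRow240930b1`,
`O5.HeegnerLogTransportThreeHeegnerIndexEnd`, `AdditivePotMult.RankOneIndexCertificateOdd`, `Literature.NumberTheory.EllipticCurves.HeegnerPointFiniteIndex` — all in the tree at
filing; the typer's own standalone farm check on tree imports (rc 0 / 0 warnings / 0 sorries; `#print axioms` of the END(s) standard) and DEDUP (`lean search --decl` on the 8 new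
names + 2 instances: no match; the gate's statement-level dedup at dry-run) precede the proposal. CONTENT LABELS: as the source's module text above states (declarations:
`bsdp_of_rankOne_of_indexUnit`, `o5_bsdp_of_good_companion_heegnerIndex`, `Wd240930b1_551`, `twistChange551`, `isGloballyMinimal_Wd240930b1_551`, `twist_W240930b1_551`,
`padicValRat_u_twistChange551`, `o5_bsdp_row240930b1`); 0 `@[conjecture]`, 0 Literature facts (net named-fact debt 0), no `sorry`; published inputs stay displayed hypotheses BY
NAME, nothing re-proved. HONEST FRAMING (cell `b2b-bsdres`): research route, lane CLASS-CLOSURE §3.5 O5; CONDITIONAL ENDs — nothing asserted beyond the displayed binders, nothing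
booked, no mark / label / count / tier of `RESIDUAL-MAP.md` moves; census / instrument statements = EVIDENCE or displayed binders, never a Literature fact; O5 OPEN.
-/

set_option autoImplicit false

noncomputable section

open scoped Classical

open WeierstrassCurve Literature.NumberTheory.EllipticCurves
  Literature.NumberTheory.EllipticCurves.ModularForms
  Literature.NumberTheory.EllipticCurves.Rank1Residual
  Literature.NumberTheory.EllipticCurves.Rank1Residual.Typed
  Literature.NumberTheory.EllipticCurves.KrizLi2019
open Summit.BirchSwinnertonDyer.Rank1Residual.AdditivePotMult (bsdp_of_rankOne_of_indexCertificate)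
open Summit.BirchSwinnertonDyer.Rank1Residual.X11b (isGloballyMinimal_of_krausCriterion_support)
open IsDedekindDomain (HeightOneSpectrum)
open scoped NumberField

namespace Summit.BirchSwinnertonDyer.Rank1Residual.O5.HeegnerLogTransport

/-! ## §1 The closing law with the index certificate replaced by a transported index statement -/

/-- **Rank one, any odd `p ∣ N_E`, `ρ̄_{E,p}` onto: `BSD(E, p)` from a TRANSPORTED index statement.**
additive-p1's `AdditivePotMult.bsdp_of_rankOne_of_indexCertificate` (Kolyvagin's bound via McCallum 1991 §1,
Gross–Zagier, Gross–Zagier–Kolyvagin over `ℚ`, modularity — all BY NAME) with its certificate binder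
`hI : ¬ p ∣ [E(K) : ℤP]` replaced by `hv : P non-torsion → ord_p [E(K) : ℤP] = 0` (the shape of every KL3
transport END). Derived inside, not assumed: `P` is non-torsion (`r_an(E) = 1`, `L(E^{d_K},1) ≠ 0` from
`q_d ≠ 0`, Gross–Zagier BY NAME: `lDerivEK_ne_zero_iff_not_isOfFinAddOrder`); the index is finite
(Kolyvagin BY NAME: `index_zmultiples_ne_zero_of_isHeegnerPoint`), so `ord_p = 0` is `p ∤ index`;
`w_K = 2` (`d_K < −4`). Per pair; conditional on the displayed binders; nothing booked.
[cite: McCallumLMS1991, §1 Theorem (Kolyvagin), p. 296] [cite: GrossLMS1991, §1 Thm. 1.3 and §2 Prop. 2.1 (2)]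
[cite: GrossZagier1986, Thm. I.6.3 with V.§2] [cite: JetchevSkinnerWan2017, §7.4.1 (eq:gz for K′)]
[cite: Miller2011LMS, Def. 1.1] -/
theorem bsdp_of_rankOne_of_indexUnit
    (W : WeierstrassCurve ℚ) [W.IsElliptic] [W.IsGloballyMinimal] (p : ℕ) [Fact p.Prime]
    (N : ℕ) [NeZero N] (K : Type) [Field K] [NumberField K]
    (Dt : ModularParametrizationData W N) (H : HeegnerDatum N (NumberField.discr K)) (ι : K →+* ℂ)
    (P : (W.baseChange K).toAffine.Point)
    -- the published inputs (named facts of the tree)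
    (hGZ : gross_zagier N W K) (hKo : kolyvagin N W K)
    (hB : Kolyvagin1990_padicValNat_card_sha_le N W K)
    (hGZK : rank_eq_analyticRank_of_analyticRank_le_one) (hmodE : hasEntireLFunction_rat)
    -- the pair and the Heegner data
    (hK : IsImaginaryQuadratic K) (hHN : SatisfiesHeegnerHypothesis N K)
    (hdK : NumberField.discr K < -4)
    (hP : WeierstrassCurve.Affine.Point.map ι.toRatAlgHom P = heegnerPointComplex Dt H)
    (hp2 : p ≠ 2) (hc : ¬ (p : ℤ) ∣ Dt.c) (hr : W.analyticRank = 1) (hsurj : Surj W p)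
    (Wd : WeierstrassCurve ℚ) [Wd.IsElliptic] [Wd.IsGloballyMinimal] (Cd : VariableChange ℚ)
    (hWd : Cd • W.quadraticTwist (NumberField.discr K : ℚ) = Wd)
    (hu : padicValRat p (Cd.u : ℚ) = 0)
    -- the twist-value datum and the Tamagawa side condition
    (qd : ℚ) (hqd : Wd.entireLFunction 1 / (Wd.realPeriodRat : ℂ) = (qd : ℂ)) (hqd0 : qd ≠ 0)
    (hvd : padicValRat p qd = 0) (htam : ¬ p ∣ W.tamagawaProduct)
    -- the TRANSPORTED index statement (conclusion shape of every KL3 END)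
    (hv : ¬ IsOfFinAddOrder P → padicValNat p (AddSubgroup.zmultiples P).index = 0) :
    BSDp W p := by
  have hp : p.Prime := Fact.out
  -- `w_K = 2`, prime to the odd `p`
  have hμ : ¬ p ∣ NumberField.Units.torsionOrder K := by
    rw [Literature.NumberTheory.DiophantineGeometry.torsionOrder_eq_two_of_discr_lt hK.1 hdK]
    intro h2
    exact hp2 ((Nat.prime_dvd_prime_iff_eq hp Nat.prime_two).mp h2)
  -- the twist's central value is non-zero (read off the datum `q_d ≠ 0`)
  have hD0 : (NumberField.discr K : ℚ) ≠ 0 := by exact_mod_cast NumberField.discr_ne_zero K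
  haveI hEt : (W.quadraticTwist (NumberField.discr K : ℚ)).IsElliptic := W.isElliptic_quadraticTwist hD0
  have hLt' : (W.quadraticTwist (NumberField.discr K : ℚ)).entireLFunction = Wd.entireLFunction := by
    rw [← hWd, entireLFunction_smul]
  have hLt : (W.quadraticTwist (NumberField.discr K : ℚ)).entireLFunction 1 ≠ 0 := by
    rw [hLt']
    intro h0
    apply hqd0
    have : ((qd : ℂ)) = 0 := by rw [← hqd, h0, zero_div]
    exact_mod_cast this
  -- the Heegner point is non-torsion: `L'(E/K,1) = L'(E,1)·L(E^{d_K},1) ≠ 0` and Gross–Zagier BY NAME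
  have hPH : IsHeegnerPoint N W K P := ⟨Dt, H, ι, hP⟩
  have hL0 : W.entireLFunction 1 = 0 := entireLFunction_one_eq_zero_of_analyticRank_eq_one hr
  obtain ⟨-, hderiv⟩ := leadingLCoeff_eq_deriv_of_analyticRank_eq_one hr
  have hLK : LDerivEK W K ≠ 0 := by
    rw [lDerivEK_eq_deriv_mul W K hmodE hL0]
    exact mul_ne_zero hderiv hLt
  have hnt : ¬ IsOfFinAddOrder P :=
    (lDerivEK_ne_zero_iff_not_isOfFinAddOrder W N K hGZ hK hHN hPH).mp hLK
  -- Kolyvagin BY NAME: the index is finite, so the transported `ord_p = 0` is `p ∤ index`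
  have hI0 : (AddSubgroup.zmultiples P).index ≠ 0 :=
    index_zmultiples_ne_zero_of_isHeegnerPoint N W K hKo hK hHN hPH hnt
  have hI : ¬ p ∣ (AddSubgroup.zmultiples P).index := by
    rcases padicValNat.eq_zero_iff.mp (hv hnt) with h1 | h0 | hnd
    · exact absurd h1 hp.one_lt.ne'
    · exact absurd h0 hI0
    · exact hnd
  exact bsdp_of_rankOne_of_indexCertificate W p N K Dt H ι P hGZ hKo hB hGZK hmodE hK hHN hP hp2 hc hμ hr
    hsurj Wd Cd hWd hu qd hqd hqd0 hvd hI htam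

/-! ## §2 The Heegner-index END (part 27b) in closing currency: `BSD(W, 3)` -/

/-- **O5 (t′) TRANSPORT END IN CLOSING CURRENCY (o5-r2 GEN 32).** `W/ℚ` additive at `3` with `ρ̄_{W,3}`
onto, `3 ∤ ∏c(W)`, `r_an(W) = 1`; `G/ℚ` a mod-`3` congruent companion with GOOD reduction at `3`; a common
Heegner field `K` (`d_K < −4`, `3` split) with Heegner points `P ∈ W(K)`, `P′ ∈ G(K)`; off-`3` depletion
factors units; Manin constants prime to `3`; a `3`-primitive point `Q ∈ G(K)` of infinite order and the
companion's Heegner index prime to `3`; the twist `Wd = Cd • W^{(d_K)}` (globally minimal, `ord₃ u = 0`)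
with value datum `L(Wd,1)/Ω(Wd) = q_d`, `q_d ≠ 0`, `ord₃ q_d = 0`. ASSUMING BY NAME Kriz–Li Thm. 1.16
(`hKL`), modularity (`hmod`, `hmodE`), Gross–Zagier / Kolyvagin / Kolyvagin's bound for `W/K` (`hGZ`,
`hKo`, `hB`) and Gross–Zagier–Kolyvagin over `ℚ` (`hGZK`): `BSD(W, 3)`. The non-torsion of `P` is
DERIVED (§1); that of `P′` stays displayed. Proof: §1 with part 27b's
`o5_index_unit_of_good_companion_heegnerIndex`. Conditional theorem; research route; O5 OPEN; nothing booked.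
[cite: KrizLi2019, Thm. 1.16, Rem. 1.17] [cite: McCallumLMS1991, §1 Theorem (Kolyvagin), p. 296]
[cite: GrossZagier1986, Thm. I.6.3 with V.§2] [cite: Castella2018, proof of Thm. 2.3, (calcul) (arXiv:1704.06608 p. 6)] -/
theorem o5_bsdp_of_good_companion_heegnerIndex
    (hKL : KrizLi2019.thm116_padicLogHeegner_congruence) (hmod : exists_isNewformOf)
    (hmodE : hasEntireLFunction_rat) (hGZK : rank_eq_analyticRank_of_analyticRank_le_one)
    (W G : WeierstrassCurve ℚ) [W.IsElliptic] [W.IsGloballyMinimal] [G.IsElliptic] [G.IsGloballyMinimal]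
    (hcong : ∀ ℓ : ℕ, ℓ.Prime → ¬ (ℓ ∣ 3 * W.conductorNorm ℤ * G.conductorNorm ℤ) →
      ((W.LFunction ℓ : ℤ) : ZMod 3) = ((G.LFunction ℓ : ℤ) : ZMod 3))
    (hρ : W.HasSurjectiveModNGaloisRep 3) (hadd : Addv W 3) (hr : W.analyticRank = 1)
    (hunitW : ∀ ℓ ∈ klSet W G, ℓ ≠ 3 → padicValInt 3 (nsCount W ℓ) = 0)
    (hunitG : ∀ ℓ ∈ klSet G W, ℓ ≠ 3 → padicValInt 3 (nsCount G ℓ) = 0)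
    (htam : ¬ 3 ∣ W.tamagawaProduct) (hgoodG : G.HasGoodReductionAtPrime 3)
    {N N' : ℕ} [NeZero N] [NeZero N'] (D : ModularParametrizationData W N)
    (D' : ModularParametrizationData G N')
    (K : Type) [Field K] [NumberField K] (hK : IsImaginaryQuadratic K)
    (hGZ : gross_zagier N W K) (hKo : kolyvagin N W K) (hB : Kolyvagin1990_padicValNat_card_sha_le N W K)
    (hH : SatisfiesHeegnerHypothesis N K) (hH' : SatisfiesHeegnerHypothesis N' K)
    (h3K : SatisfiesHeegnerHypothesis 3 K) (hd : NumberField.discr K < -4)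
    (H : HeegnerDatum N (NumberField.discr K)) (H' : HeegnerDatum N' (NumberField.discr K))
    (ι : K →+* ℂ) (ι₃ : K →+* ℚ_[3])
    (P : (W.baseChange K).toAffine.Point) (P' Q : (G.baseChange K).toAffine.Point)
    (hP : WeierstrassCurve.Affine.Point.map ι.toRatAlgHom P = heegnerPointComplex D H)
    (hP' : WeierstrassCurve.Affine.Point.map ι.toRatAlgHom P' = heegnerPointComplex D' H')
    (hP'inf : ¬ IsOfFinAddOrder P') (hQ : ¬ IsOfFinAddOrder Q)
    (hQunit : X11b.padicLogOrd G 3 ι₃ Q + padicValInt 3 (nsCount G 3) - 1 = 0)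
    (hIdx : ¬ 3 ∣ (AddSubgroup.zmultiples P').index)
    (hc3 : ¬ ((3 : ℤ) ∣ D.maninConstant)) (hc3' : ¬ ((3 : ℤ) ∣ D'.maninConstant))
    (Wd : WeierstrassCurve ℚ) [Wd.IsElliptic] [Wd.IsGloballyMinimal] (Cd : VariableChange ℚ)
    (hWd : Cd • W.quadraticTwist (NumberField.discr K : ℚ) = Wd) (hu : padicValRat 3 (Cd.u : ℚ) = 0)
    (qd : ℚ) (hqd : Wd.entireLFunction 1 / (Wd.realPeriodRat : ℂ) = (qd : ℂ)) (hqd0 : qd ≠ 0)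
    (hvd : padicValRat 3 qd = 0) :
    BSDp W 3 := by
  haveI : Fact (Nat.Prime 3) := ⟨Nat.prime_three⟩
  have hc : ¬ ((3 : ℕ) : ℤ) ∣ D.c := by rw [Nat.cast_ofNat]; exact hc3
  exact bsdp_of_rankOne_of_indexUnit W 3 N K D H ι P hGZ hKo hB hGZK hmodE hK hH hd hP (by decide) hc hr hρ
    Wd Cd hWd hu qd hqd hqd0 hvd htam fun hPinf =>
      o5_index_unit_of_good_companion_heegnerIndex hKL hmod W G hcong hρ hadd hunitW hunitG htam hgoodG D D'
        K hK hH hH' h3K hd H H' ι ι₃ P P' Q hP hP' hPinf hP'inf hQ hQunit hIdx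
        (padicValInt.eq_zero_of_not_dvd hc3) hc3'

/-! ## §3 The ROW OF RECORD `240930b1 ~ 26770a1`, `d_K = −551`: `BSDp 240930b1 3` -/

namespace KL3TwoSidedRows

/-- A globally minimal model of the quadratic twist `240930b1^(−551)` (conductor `240930·551² = 73146588930`):
`(u, r, s, t) = (1, 0, ½, 0)` applied to the tree's `quadraticTwist (−551)` (§3 `twist_W240930b1_551`).
[cite: CremonaAlgorithms1997, §3.2] -/
def Wd240930b1_551 : WeierstrassCurve ℚ := ⟨1, 413, 0, -1790254339134, -923018597583800140⟩

/-- The change of variables `(u, r, s, t) = (1, 0, ½, 0)` (so `u = 1`). [cite: SilvermanAEC2009, III.1 Table 3.1] -/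
def twistChange551 : VariableChange ℚ := ⟨1, 0, (1 : ℚ) / 2, 0⟩

/-- `Δ(Wd240930b1_551) = −2³⁴·3⁹·5²·19⁶·29⁶·2677 ≠ 0`. [folklore] -/
instance : Wd240930b1_551.IsElliptic := ⟨by
  rw [isUnit_iff_ne_zero]
  norm_num [Wd240930b1_551, WeierstrassCurve.Δ, WeierstrassCurve.b₂, WeierstrassCurve.b₄,
    WeierstrassCurve.b₆, WeierstrassCurve.b₈]⟩

/-- `Wd240930b1_551` is globally minimal: `|Δ| = 2³⁴·3⁹·5²·19⁶·29⁶·2677`; at `2`, `2⁴ ∤ c₄ = 85932211010841`;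
elsewhere `v_q Δ < 12`. [cite: SilvermanAEC2009, VII.1 Remark 1.1] [cite: Kraus1989, Prop. 1 and Prop. 2] -/
theorem isGloballyMinimal_Wd240930b1_551 : Wd240930b1_551.IsGloballyMinimal :=
  isGloballyMinimal_of_krausCriterion_support 1 413 0 (-1790254339134) (-923018597583800140)
    [(2, 1, 34), (3, 2, 9), (5, 1, 2), (19, 2, 6), (29, 2, 6), (2677, 1, 1)]
    (by intro t ht; simp only [List.mem_cons, List.not_mem_nil, or_false] at ht
        rcases ht with rfl | rfl | rfl | rfl | rfl | rfl <;> norm_num)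
    (by decide +kernel) (by decide +kernel)

/-- Instance form of `isGloballyMinimal_Wd240930b1_551` (typer lint docstring). [cite: Kraus1989, Prop. 1 and Prop. 2] -/
instance : Wd240930b1_551.IsGloballyMinimal := isGloballyMinimal_Wd240930b1_551

/-- **The twist identity IN THE KERNEL**: `(1, 0, ½, 0) • 240930b1.quadraticTwist (−551) = Wd240930b1_551`
(`b₂, b₄, b₆ = −3, −11793468, 22070676560`; `a₂ = (−551·b₂ − 1)/4 = 413`, `a₄ = 551²·b₄/2`, `a₆ = −551³·b₆/4`).
[cite: SilvermanAEC2009, III.1 Table 3.1 and X.5 Cor. 5.4] -/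
theorem twist_W240930b1_551 :
    twistChange551 • W240930b1.quadraticTwist ((-551 : ℤ) : ℚ) = Wd240930b1_551 := by
  ext <;> norm_num [WeierstrassCurve.variableChange_def, WeierstrassCurve.quadraticTwist, W240930b1,
    Wd240930b1_551, twistChange551, WeierstrassCurve.b₂, WeierstrassCurve.b₄, WeierstrassCurve.b₆]

/-- `u = 1` for `twistChange551`, so `ord₃ u = 0`. [folklore] -/
theorem padicValRat_u_twistChange551 : padicValRat 3 (twistChange551.u : ℚ) = 0 := by
  simp [twistChange551]

end KL3TwoSidedRows

open KL3TwoSidedRows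

/-- **THE TWO-SIDED ROW OF RECORD IN CLOSING CURRENCY: `BSD(240930b1, 3)`** — part 25c's
`o5_index_unit_row240930b1` (`W := 240930b1`, `G := 26770a1`, `Gd := Gd551`, every finitary binder decided
in the kernel there) composed with §1 at the level `N` of `W`'s parametrisation datum (`N = 240930` for the `X₀`-optimal one): the Heegner point `P ∈ W(K)` is no longer
assumed non-torsion (DERIVED from `r_an(W) = 1`, the twist value `q_d ≠ 0` and Gross–Zagier BY NAME), the
index finiteness is Kolyvagin BY NAME, `ord₃ u = 0` and the twist identity
`(1,0,½,0) • W^{(d_K)} = Wd240930b1_551` are kernel facts (§3), `3 ∤ ∏c(W)` is part 25c's `tam3_W240930b1`.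
DISPLAYED BINDERS: the published theorems `hKL` (Kriz–Li 1.16), `hYZ` (Yan–Zhu 4.15), `hW20` (Wuthrich
L.20), `hmod`/`hmodE` (modularity), `hGZK`, and for `W/K` at level `N`: `hGZ`, `hKo`, `hB`; for
`G/K`: `hKoG`, `hGZG`; the ROW DATA `hρ` (`ρ̄_{W,3}` onto), `hr` (`r_an(W) = 1`), the parametrisation /
Heegner data of `W` and `G` over a field with `d_K = −551`, `hP'inf`, the two sharp `3`-descents `hSelG`,
`hSelGd`, the Manin units `hc3`, `hc3'`, and the twist-value datum `q_d` (`hqd`, `hqd0`, `hvd`; record row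
`O5/HeegnerIndexRecordsThreeRankOneT2`: `#F(ℚ)_tors = 2`, `∏c_ℓ(F) = 64`, `#Ш_an(F) = 4`). CONCLUSION:
`BSDp W240930b1 3`. Conditional theorem; research route; O5 OPEN; nothing booked; the same statement is the
record-row reading of p238704 on `240930b1 / −551` (`m₁ = m₂ = 16`) — two evidence ledgers, one conclusion.
[cite: KrizLi2019, Theorem 1.16 (arXiv:1609.06687v4 pp. 7-8)] [cite: McCallumLMS1991, §1 Theorem (Kolyvagin), p. 296]
[cite: GrossZagier1986, Thm. I.6.3] [cite: Kolyvagin1990, Thm. A] [cite: YanZhu2026, Theorem 4.15]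
[cite: CremonaAlgorithms1997, Table 1] -/
theorem o5_bsdp_row240930b1
    (hKL : KrizLi2019.thm116_padicLogHeegner_congruence)
    (hYZ : YanZhu2026.thm415_padicValRat_bsd_rank_le_one)
    (hW20 : Wuthrich2014.lemma20_surjective_threeAdic_of_semistable)
    (hmod : exists_isNewformOf) (hmodE : hasEntireLFunction_rat)
    (hGZK : rank_eq_analyticRank_of_analyticRank_le_one)
    (hρ : W240930b1.HasSurjectiveModNGaloisRep 3) (hr : W240930b1.analyticRank = 1)
    {N N' : ℕ} [NeZero N] [NeZero N'] (D : ModularParametrizationData W240930b1 N)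
    (D' : ModularParametrizationData G26770a1 N')
    (K : Type) [Field K] [NumberField K] (hK : IsImaginaryQuadratic K) (hdK : NumberField.discr K = -551)
    (hH : SatisfiesHeegnerHypothesis N K) (hH' : SatisfiesHeegnerHypothesis N' K)
    (h3K : SatisfiesHeegnerHypothesis 3 K)
    (hGZ : gross_zagier N W240930b1 K) (hKo : kolyvagin N W240930b1 K)
    (hB : Kolyvagin1990_padicValNat_card_sha_le N W240930b1 K)
    (hKoG : kolyvagin N' G26770a1 K) (hGZG : gross_zagier N' G26770a1 K)
    (H : HeegnerDatum N (NumberField.discr K)) (H' : HeegnerDatum N' (NumberField.discr K))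
    (ι : K →+* ℂ) (ι₃ : K →+* ℚ_[3])
    (P : (W240930b1.baseChange K).toAffine.Point) (P' : (G26770a1.baseChange K).toAffine.Point)
    (hP : WeierstrassCurve.Affine.Point.map ι.toRatAlgHom P = heegnerPointComplex D H)
    (hP' : WeierstrassCurve.Affine.Point.map ι.toRatAlgHom P' = heegnerPointComplex D' H')
    (hP'inf : ¬ IsOfFinAddOrder P')
    (hSelG : Nat.card (G26770a1.selmerGroup (3 : ℤ)) = 3 ^ G26770a1.mordellWeilRank)
    (hSelGd : Nat.card (Gd551.selmerGroup (3 : ℤ)) = 3 ^ Gd551.mordellWeilRank)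
    (hc3 : ¬ ((3 : ℤ) ∣ D.maninConstant)) (hc3' : ¬ ((3 : ℤ) ∣ D'.maninConstant))
    (qd : ℚ) (hqd : Wd240930b1_551.entireLFunction 1 / (Wd240930b1_551.realPeriodRat : ℂ) = (qd : ℂ))
    (hqd0 : qd ≠ 0) (hvd : padicValRat 3 qd = 0) :
    BSDp W240930b1 3 := by
  have hd : NumberField.discr K < -4 := by rw [hdK]; norm_num
  have hc : ¬ ((3 : ℕ) : ℤ) ∣ D.c := by rw [Nat.cast_ofNat]; exact hc3
  have hWd : twistChange551 • W240930b1.quadraticTwist (NumberField.discr K : ℚ) = Wd240930b1_551 := by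
    rw [hdK]; exact twist_W240930b1_551
  exact bsdp_of_rankOne_of_indexUnit W240930b1 3 N K D H ι P hGZ hKo hB hGZK hmodE hK hH hd hP
    (by decide) hc hr hρ Wd240930b1_551 twistChange551 hWd padicValRat_u_twistChange551 qd hqd hqd0 hvd
    tam3_W240930b1 fun hPinf =>
      o5_index_unit_row240930b1 hKL hYZ hW20 hmod hGZK hρ D D' K hK hdK hH hH' h3K hKoG hGZG H H' ι ι₃ P P'
        hP hP' hPinf hP'inf hSelG hSelGd (padicValInt.eq_zero_of_not_dvd hc3) hc3'

end Summit.BirchSwinnertonDyer.Rank1Residual.O5.HeegnerLogTransport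

end
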